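import Summits.Ventures.HSemireg.WedgeHankelRecurrenceModule
import Summits.Ventures.HSemireg.WedgeHankelKernelColumnSpaceNodes

/-!
# Venture HSemireg — THE RECURRENCE SPACE IS A `GL₂`-COVARIANT: for every substitution `g = (α β; γ δ)` with `det g ≠ 0`, **`p ∈ Rec_k(sbSeq g N q) ↔ g ⋆ p ∈ Rec_k(q)`**
# (`k ≤ N`, `deg p ≤ k`), where `g ⋆ p = Σ_a p_a (α + γX)^{k−a} (β + δX)^a` is the action of `g` on binary `k`-forms; the mechanism is THE MOMENT MATRIX IN CLOSED FORM
# **`S_c(g)_{a,l} = [X^l] (α + γX)^{c−a} (β + δX)^a`** and H7's `H_k(sbSeq g q) = S_k H_k(q) S_{N−k}ᵀ`; shear ↦ Taylor shift, swap ↦ reflection (N22's generators recovered)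

HONEST FRAMING. Part of the Lean index of the computation cell `pub-hsemireg` (seat p10 gen 26, Sunday typer «UNIFORM-IN-n»).
LINEAR ALGEBRA OF HANKEL (catalecticant) MATRICES and of polynomials over a field ONLY: no variety, no cohomology theory, no sheaf, no Ext group and no semiregularity map is constructed
here; nothing here says that HC / HC_CM / HC_AV holds; no Literature fact is declared or used.  Custodian versions as in `WedgeHankelSiegelIdeal` (1/3); the dictionary (`sbSeq g m q` = the
moment transform of H1: the moments `q_j = L(u^{m−j}v^j)` become `L((αu+γv)^{m−j}(βu+δv)^j)`; `Rec_k(q) ⊆ K[X]_{≤k}` read as binary `k`-forms) is QUOTED, never asserted.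

WHAT IS IN THE TREE / KEYED.  N18 (`WedgeHankelRecurrenceModule`, № 173): `recSpace`, `mem_recSpace_iff_vecMul_eq_zero`, `finrank_recSpace_eq`, `mem_degreeLT_succ_iff`; H1
(`WedgeHankelSubstitution`, tree) `sbSeq` + its recursion / `sbSeq_zero_seq`; H7 (`WedgeHankelSubstitutionCatalecticant`, tree) `sbMat`, **`hankel1_sbSeq_eq_mul`** (`H_k(sbSeq g N q) =
S_k · H_k(q) · S_{N−k}ᵀ`); N4 (`WedgeHankelKernelColumnSpaceNodes`, tree) `isUnit_sbMat_of_det_ne_zero`; H1b (`WedgeHankelSubstitutionSiegel`) `rank_hankel1_sbSeq`.  Mathlib: `Polynomial.coeff_X_mul`,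
`Polynomial.taylor_monomial`, `Polynomial.reflect_C_mul_X_pow`, `Matrix.vecMul_vecMul`, `Matrix.mul_nonsing_inv`.
THIS FILE (namespace `Summit.Ventures.HSemireg.Wedge.HankelOuter` continued; CHAINED on N18; 1 definition `sbPoly`):
* §486 `coeff_C_add_C_mul_X_mul_succ` / `_zero`, `hankelShift_single_succ`, `hankelShift_single_zero`; THE MOMENT MATRIX IN CLOSED FORM **`sbSeq_single_eq_coeff`** (`a ≤ m`:
  `sbSeq g m δ_l a = [X^l] (α + γX)^{m−a} (β + δX)^a`, by H1's double recursion) and **`sbMat_apply_eq_coeff`** (`S_c(g)_{a,l} = [X^l] (α + γX)^{c−a} (β + δX)^a`).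
* §487 the BINARY-FORM ACTION `sbPoly g m p := Σ_{a ≤ m} p_a (α + γX)^{m−a} (β + δX)^a` (`natDegree_linear_pow_mul_le`, `sbPoly_mem_degreeLT`, **`coeff_sbPoly`** and
  **`degreeLTEquiv_sbPoly`**: `coeffvec(g ⋆ p) = coeffvec(p) ᵥ* S_m(g)`, `sbPoly_add`, `sbPoly_smul`); the generators: **`sbPoly_shear`** (`(1 λ; 0 1) ⋆ p = taylor λ p`),
  **`sbPoly_swap`** (`(0 1; 1 0) ⋆ p = reflect_m p`, via `polynomial_reflect_finset_sum`), `sbPoly_diag_X_pow` (`(α 0; 0 δ) ⋆ X^a = α^{m−a} δ^a X^a`).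
* §488 `vecMul_hankel1_sbSeq` (`a ᵥ* H_k(sbSeq g q) = ((a ᵥ* S_k) ᵥ* H_k(q)) ᵥ* S_{N−k}ᵀ`), `vecMul_hankel1_sbSeq_eq_zero_iff` (`det g ≠ 0`), THE THEOREM **`mem_recSpace_sbSeq_iff`**
  (`k ≤ N`, `det g ≠ 0`, `deg p ≤ k`: `p ∈ Rec_k(sbSeq g N q) ↔ sbPoly g k p ∈ Rec_k(q)`), `finrank_recSpace_sbSeq` (`dim Rec_k(sbSeq g q) = dim Rec_k(q)`).
READING: N22 proved the three Bruhat generators act on recurrences by translation / dilation / reflection; this file proves it for the WHOLE substitution group in one statement, by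
identifying H7's moment matrix with the matrix of `g` on binary forms — so the minimal recurrence (N18), the divisor polynomial of a divisor class (N19/N20) and the kernel (N21) all
transform as binary forms / divisors on `P¹` under H1's `Sb`.  Nothing Ext-side.  New names only.
-/

open Module Polynomial
open scoped Matrix Polynomial

namespace Summit.Ventures.HSemireg.Wedge.HankelOuter

open Summit.Ventures.HSemireg.Wedge Summit.Ventures.HSemireg.Wedge.Hankel Summit.Ventures.HSemireg.Wedge.HankelFrameChange

variable (K : Type*) [Field K] {N : ℕ}

/-! ## §486. The moment matrix in closed form: `S_c(g)_{a,l} = [X^l] (α + γX)^{c−a} (β + δX)^a` -/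

/-- `[X^{l+1}] ((a + cX)·G) = a·[X^{l+1}]G + c·[X^l]G`. -/
theorem coeff_C_add_C_mul_X_mul_succ (a c : K) (G : K[X]) (l : ℕ) :
    ((Polynomial.C a + Polynomial.C c * Polynomial.X) * G).coeff (l + 1) = a * G.coeff (l + 1) + c * G.coeff l := by
  rw [add_mul, Polynomial.coeff_add, Polynomial.coeff_C_mul, mul_assoc, Polynomial.coeff_C_mul, Polynomial.coeff_X_mul]

/-- `[X^0] ((a + cX)·G) = a·[X^0]G`. -/
theorem coeff_C_add_C_mul_X_mul_zero (a c : K) (G : K[X]) :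
    ((Polynomial.C a + Polynomial.C c * Polynomial.X) * G).coeff 0 = a * G.coeff 0 := by
  rw [add_mul, Polynomial.coeff_add, Polynomial.coeff_C_mul, mul_assoc, Polynomial.coeff_C_mul, Polynomial.mul_coeff_zero, Polynomial.coeff_X_zero,
    zero_mul, mul_zero, add_zero]

/-- the shift of an indicator sequence. -/
theorem hankelShift_single_succ (l : ℕ) : shift K (fun i => if i = l + 1 then (1 : K) else 0) = fun i => if i = l then (1 : K) else 0 := by
  funext i
  simp only [shift_apply, Nat.add_right_cancel_iff]

/-- the shift of the indicator of `0` vanishes. -/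
theorem hankelShift_single_zero : shift K (fun i => if i = 0 then (1 : K) else 0) = fun _ => 0 := by
  funext i
  simp only [shift_apply, Nat.add_one_ne_zero, if_false]

/-- **THE MOMENT TRANSFORM OF AN INDICATOR: `sbSeq g m δ_l a = [X^l] (α + γX)^{m−a} (β + δX)^a` for `a ≤ m`** — the moment matrix `S_m(g)` is the matrix of the substitution
`(u, v) ↦ (αu + γv, βu + δv)` on binary `m`-forms `Σ_a p_a u^{m−a} v^a`, dehomogenised `u = 1`, `v = X`. -/
theorem sbSeq_single_eq_coeff (α β γ δ : K) :
    ∀ (m a l : ℕ), a ≤ m → sbSeq K α β γ δ m (fun i => if i = l then (1 : K) else 0) a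
      = ((Polynomial.C α + Polynomial.C γ * Polynomial.X) ^ (m - a) * (Polynomial.C β + Polynomial.C δ * Polynomial.X) ^ a).coeff l
  | 0, a, l, ha => by
    obtain rfl : a = 0 := Nat.le_zero.mp ha
    rw [sbSeq_zero_zero, Nat.sub_zero, pow_zero, pow_zero, one_mul, Polynomial.coeff_one]
    by_cases hl : l = 0
    · rw [if_pos hl, if_pos hl.symm]
    · rw [if_neg hl, if_neg (Ne.symm hl)]
  | m + 1, 0, 0, _ => by
    rw [sbSeq_succ_zero, hankelShift_single_zero, sbSeq_zero_seq, mul_zero, add_zero, sbSeq_single_eq_coeff α β γ δ m 0 0 (Nat.zero_le _),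
      Nat.sub_zero, Nat.sub_zero, pow_zero, mul_one, mul_one, pow_succ', coeff_C_add_C_mul_X_mul_zero]
  | m + 1, 0, l + 1, _ => by
    rw [sbSeq_succ_zero, hankelShift_single_succ, sbSeq_single_eq_coeff α β γ δ m 0 (l + 1) (Nat.zero_le _), sbSeq_single_eq_coeff α β γ δ m 0 l (Nat.zero_le _),
      Nat.sub_zero, Nat.sub_zero, pow_zero, mul_one, mul_one, pow_succ', coeff_C_add_C_mul_X_mul_succ]
  | m + 1, a + 1, 0, ha => by
    rw [sbSeq_succ_succ, hankelShift_single_zero, sbSeq_zero_seq, mul_zero, add_zero, sbSeq_single_eq_coeff α β γ δ m a 0 (by omega),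
      show m + 1 - (a + 1) = m - a by omega, pow_succ' (Polynomial.C β + _), mul_left_comm, coeff_C_add_C_mul_X_mul_zero]
  | m + 1, a + 1, l + 1, ha => by
    rw [sbSeq_succ_succ, hankelShift_single_succ, sbSeq_single_eq_coeff α β γ δ m a (l + 1) (by omega), sbSeq_single_eq_coeff α β γ δ m a l (by omega),
      show m + 1 - (a + 1) = m - a by omega, pow_succ' (Polynomial.C β + _), mul_left_comm, coeff_C_add_C_mul_X_mul_succ]

/-- matrix form: **`S_c(g)_{a,l} = [X^l] (α + γX)^{c−a} (β + δX)^a`.** -/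
theorem sbMat_apply_eq_coeff (α β γ δ : K) (c : ℕ) (a l : Fin (c + 1)) :
    sbMat K α β γ δ c (c + 1) a l = ((Polynomial.C α + Polynomial.C γ * Polynomial.X) ^ (c - (a : ℕ)) * (Polynomial.C β + Polynomial.C δ * Polynomial.X) ^ (a : ℕ)).coeff l := by
  rw [sbMat_apply, sbSeq_single_eq_coeff K α β γ δ c a l (by have := a.2; omega)]

/-! ## §487. The substitution acting on polynomials of degree `≤ m` as on binary `m`-forms -/

/-- **THE BINARY-FORM ACTION** `sbPoly g m p := Σ_{a ≤ m} p_a · (α + γX)^{m−a} (β + δX)^a` of the substitution `g = (α β; γ δ)` on a polynomial `p` read as a binary form of degree `m`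
(`v ↦ X`, `u ↦ 1`; quoted: `F(u, v) ↦ F(αu + γv, βu + δv)`). -/
noncomputable def sbPoly (α β γ δ : K) (m : ℕ) (p : K[X]) : K[X] :=
  ∑ a ∈ Finset.range (m + 1), Polynomial.C (p.coeff a) * ((Polynomial.C α + Polynomial.C γ * Polynomial.X) ^ (m - a) * (Polynomial.C β + Polynomial.C δ * Polynomial.X) ^ a)

/-- each summand `(α + γX)^{m−a} (β + δX)^a` has degree `≤ m` (`a ≤ m`). -/
theorem natDegree_linear_pow_mul_le (α β γ δ : K) {m a : ℕ} (ha : a ≤ m) :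
    ((Polynomial.C α + Polynomial.C γ * Polynomial.X) ^ (m - a) * (Polynomial.C β + Polynomial.C δ * Polynomial.X) ^ a).natDegree ≤ m := by
  have h1 : (Polynomial.C α + Polynomial.C γ * Polynomial.X).natDegree ≤ 1 :=
    (Polynomial.natDegree_add_le _ _).trans (max_le (by rw [Polynomial.natDegree_C]; exact Nat.zero_le 1) ((Polynomial.natDegree_C_mul_le _ _).trans Polynomial.natDegree_X_le))
  have h2 : (Polynomial.C β + Polynomial.C δ * Polynomial.X).natDegree ≤ 1 :=
    (Polynomial.natDegree_add_le _ _).trans (max_le (by rw [Polynomial.natDegree_C]; exact Nat.zero_le 1) ((Polynomial.natDegree_C_mul_le _ _).trans Polynomial.natDegree_X_le))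
  refine (Polynomial.natDegree_mul_le).trans ?_
  have e1 := (Polynomial.natDegree_pow_le (p := Polynomial.C α + Polynomial.C γ * Polynomial.X) (n := m - a)).trans (Nat.mul_le_mul_left _ h1)
  have e2 := (Polynomial.natDegree_pow_le (p := Polynomial.C β + Polynomial.C δ * Polynomial.X) (n := a)).trans (Nat.mul_le_mul_left _ h2)
  omega

/-- `sbPoly g m p` has degree `≤ m`. -/
theorem sbPoly_mem_degreeLT (α β γ δ : K) (m : ℕ) (p : K[X]) : sbPoly K α β γ δ m p ∈ Polynomial.degreeLT K (m + 1) := by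
  refine Submodule.sum_mem _ fun a ha => ?_
  rw [Polynomial.C_mul']
  exact Submodule.smul_mem _ _ ((mem_degreeLT_succ_iff K).mpr (natDegree_linear_pow_mul_le K α β γ δ (by have := Finset.mem_range.mp ha; omega)))

/-- the coefficients of `sbPoly g m p` are the row vector `(p_a)_a · S_m(g)`. -/
theorem coeff_sbPoly (α β γ δ : K) (m : ℕ) (p : K[X]) (l : Fin (m + 1)) :
    (sbPoly K α β γ δ m p).coeff l = ∑ a : Fin (m + 1), p.coeff a * sbMat K α β γ δ m (m + 1) a l := by
  rw [sbPoly, Polynomial.finsetSum_coeff, ← Fin.sum_univ_eq_sum_range]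
  exact Finset.sum_congr rfl fun a _ => by rw [Polynomial.coeff_C_mul, sbMat_apply_eq_coeff]

/-- in coordinates: **`coeffvec(sbPoly g m p) = coeffvec(p) ᵥ* S_m(g)`** (`deg p ≤ m`). -/
theorem degreeLTEquiv_sbPoly (α β γ δ : K) (m : ℕ) {p : K[X]} (hp : p ∈ Polynomial.degreeLT K (m + 1)) :
    Polynomial.degreeLTEquiv K (m + 1) ⟨sbPoly K α β γ δ m p, sbPoly_mem_degreeLT K α β γ δ m p⟩
      = (Polynomial.degreeLTEquiv K (m + 1) ⟨p, hp⟩) ᵥ* sbMat K α β γ δ m (m + 1) := by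
  funext l
  rw [Matrix.vecMul, dotProduct]
  exact coeff_sbPoly K α β γ δ m p l

/-- `sbPoly` is linear in `p`. -/
theorem sbPoly_add (α β γ δ : K) (m : ℕ) (p p' : K[X]) : sbPoly K α β γ δ m (p + p') = sbPoly K α β γ δ m p + sbPoly K α β γ δ m p' := by
  rw [sbPoly, sbPoly, sbPoly, ← Finset.sum_add_distrib]
  exact Finset.sum_congr rfl fun a _ => by rw [Polynomial.coeff_add, Polynomial.C_add, add_mul]

/-- … and homogeneous. -/
theorem sbPoly_smul (α β γ δ : K) (m : ℕ) (c : K) (p : K[X]) : sbPoly K α β γ δ m (c • p) = c • sbPoly K α β γ δ m p := by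
  rw [sbPoly, sbPoly, Finset.smul_sum]
  exact Finset.sum_congr rfl fun a _ => by rw [Polynomial.coeff_smul, smul_eq_mul, Polynomial.C_mul, mul_assoc, Polynomial.C_mul']

/-- the SHEAR `(1 λ; 0 1)` acts by the Taylor shift: `sbPoly (1 λ 0 1) m p = p(X + λ)` for `deg p ≤ m` (cf. N22's translation law). -/
theorem sbPoly_shear (lam : K) {m : ℕ} {p : K[X]} (hp : p ∈ Polynomial.degreeLT K (m + 1)) : sbPoly K 1 lam 0 1 m p = Polynomial.taylor lam p := by
  have hdeg : p.natDegree < m + 1 := Nat.lt_succ_of_le ((mem_degreeLT_succ_iff K).mp hp)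
  rw [sbPoly]
  conv_rhs => rw [Polynomial.as_sum_range' p (m + 1) hdeg, map_sum]
  refine Finset.sum_congr rfl fun a _ => ?_
  rw [map_zero, zero_mul, add_zero, map_one, one_pow, one_mul, one_mul, Polynomial.taylor_monomial, add_comm]

/-- `reflect` through a finite sum. -/
theorem polynomial_reflect_finset_sum {ι : Type*} (s : Finset ι) (m : ℕ) (f : ι → K[X]) :
    Polynomial.reflect m (∑ i ∈ s, f i) = ∑ i ∈ s, Polynomial.reflect m (f i) := by
  classical
  induction s using Finset.induction_on with
  | empty => rw [Finset.sum_empty, Finset.sum_empty, Polynomial.reflect_zero]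
  | insert a s ha ih => rw [Finset.sum_insert ha, Finset.sum_insert ha, Polynomial.reflect_add, ih]

/-- the SWAP `(0 1; 1 0)` acts by reflection: `sbPoly (0 1 1 0) m p = reflect_m p` for `deg p ≤ m` (cf. N22's inversion law). -/
theorem sbPoly_swap {m : ℕ} {p : K[X]} (hp : p ∈ Polynomial.degreeLT K (m + 1)) : sbPoly K 0 1 1 0 m p = Polynomial.reflect m p := by
  have hdeg : p.natDegree < m + 1 := Nat.lt_succ_of_le ((mem_degreeLT_succ_iff K).mp hp)
  rw [sbPoly]
  conv_rhs => rw [Polynomial.as_sum_range' p (m + 1) hdeg, polynomial_reflect_finset_sum]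
  refine Finset.sum_congr rfl fun a ha => ?_
  rw [map_zero, zero_add, map_one, one_mul, zero_mul, add_zero, one_pow, mul_one, ← Polynomial.C_mul_X_pow_eq_monomial, Polynomial.reflect_C_mul_X_pow,
    Polynomial.revAt_le (by have := Finset.mem_range.mp ha; omega)]

/-- the DIAGONAL `(α 0; 0 δ)` acts by `p ↦ α^m p(δX/α)`-type dilation: `sbPoly (α 0 0 δ) m (X^a) = α^{m−a} δ^a X^a` (`a ≤ m`). -/
theorem sbPoly_diag_X_pow (α δ : K) {m a : ℕ} (ha : a ≤ m) :
    sbPoly K α 0 0 δ m (Polynomial.X ^ a) = Polynomial.C (α ^ (m - a) * δ ^ a) * Polynomial.X ^ a := by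
  rw [sbPoly, Finset.sum_eq_single a]
  · rw [Polynomial.coeff_X_pow_self, map_one, one_mul, map_zero, zero_mul, add_zero, zero_add, ← Polynomial.C_pow, mul_pow, ← Polynomial.C_pow,
      map_mul, mul_assoc]
  · intro b _ hb
    rw [Polynomial.coeff_X_pow, if_neg hb, map_zero, zero_mul]
  · intro h
    exact absurd (Finset.mem_range.mpr (by omega)) h

/-! ## §488. THE RECURRENCE SPACE IS A `GL₂`-COVARIANT: `p ∈ Rec_k(sbSeq g N q) ↔ sbPoly g k p ∈ Rec_k(q)` -/

/-- left-kernel transport: `a ᵥ* H_k(sbSeq g q) = ((a ᵥ* S_k) ᵥ* H_k(q)) ᵥ* S_{N−k}ᵀ` (`k ≤ N`; H7). -/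
theorem vecMul_hankel1_sbSeq {k : ℕ} (hk : k ≤ N) (α β γ δ : K) (q : ℕ → K) (a : Fin (k + 1) → K) :
    a ᵥ* hankel1 K N k (sbSeq K α β γ δ N q) = ((a ᵥ* sbMat K α β γ δ k (k + 1)) ᵥ* hankel1 K N k q) ᵥ* (sbMat K α β γ δ (N - k) (N + 1 - k))ᵀ := by
  rw [hankel1_sbSeq_eq_mul K hk, ← Matrix.vecMul_vecMul, ← Matrix.vecMul_vecMul]

/-- for `det g ≠ 0` the right factor is invertible: `a ᵥ* H_k(sbSeq g q) = 0 ↔ (a ᵥ* S_k(g)) ᵥ* H_k(q) = 0`. -/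
theorem vecMul_hankel1_sbSeq_eq_zero_iff {k : ℕ} (hk : k ≤ N) {α β γ δ : K} (hdet : α * δ - β * γ ≠ 0) (q : ℕ → K) (a : Fin (k + 1) → K) :
    a ᵥ* hankel1 K N k (sbSeq K α β γ δ N q) = 0 ↔ (a ᵥ* sbMat K α β γ δ k (k + 1)) ᵥ* hankel1 K N k q = 0 := by
  have hU : IsUnit (sbMat K α β γ δ (N - k) (N + 1 - k))ᵀ :=
    (Matrix.isUnit_transpose _).mpr (isUnit_sbMat_of_det_ne_zero K (c := N - k) (d := N + 1 - k) (by omega) hdet)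
  rw [vecMul_hankel1_sbSeq K hk]
  constructor
  · intro h
    have := congrArg (fun v => v ᵥ* ((sbMat K α β γ δ (N - k) (N + 1 - k))ᵀ)⁻¹) h
    rwa [Matrix.vecMul_vecMul, Matrix.mul_nonsing_inv _ ((Matrix.isUnit_iff_isUnit_det _).mp hU), Matrix.vecMul_one, Matrix.zero_vecMul] at this
  · intro h
    rw [h, Matrix.zero_vecMul]

/-- **THE RECURRENCE SPACE IS A `GL₂`-COVARIANT: for `k ≤ N`, `det g ≠ 0` and `deg p ≤ k`, `p ∈ Rec_k(sbSeq g N q) ↔ sbPoly g k p ∈ Rec_k(q)`** — a substitution of the node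
coordinate moves the recurrences of window `k + 1` exactly as it moves binary `k`-forms. -/
theorem mem_recSpace_sbSeq_iff {k : ℕ} (hk : k ≤ N) {α β γ δ : K} (hdet : α * δ - β * γ ≠ 0) (q : ℕ → K) {p : K[X]} (hp : p ∈ Polynomial.degreeLT K (k + 1)) :
    p ∈ recSpace K N (sbSeq K α β γ δ N q) k ↔ sbPoly K α β γ δ k p ∈ recSpace K N q k := by
  have h1 := mem_recSpace_iff_vecMul_eq_zero K (N := N) (sbSeq K α β γ δ N q) ⟨p, hp⟩
  have h2 := mem_recSpace_iff_vecMul_eq_zero K (N := N) q ⟨sbPoly K α β γ δ k p, sbPoly_mem_degreeLT K α β γ δ k p⟩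
  simp only at h1 h2
  rw [h1, h2, degreeLTEquiv_sbPoly K α β γ δ k hp, vecMul_hankel1_sbSeq_eq_zero_iff K hk hdet]

/-- dimensions agree: `dim Rec_k(sbSeq g N q) = dim Rec_k(q)` for `det g ≠ 0` (H1b's rank invariance, every `k`). -/
theorem finrank_recSpace_sbSeq {α β γ δ : K} (hdet : α * δ - β * γ ≠ 0) (k : ℕ) (q : ℕ → K) :
    finrank K (recSpace K N (sbSeq K α β γ δ N q) k) = finrank K (recSpace K N q k) := by
  rw [finrank_recSpace_eq, finrank_recSpace_eq, rank_hankel1_sbSeq K hdet]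

end Summit.Ventures.HSemireg.Wedge.HankelOuter
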